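import Summits.CriticalPhenomena.Ising3DConformalLimit.Theses.PerfectScreening
import Literature.Probability.LatticeModels.LatticeBootstrapFeasible

/-!
# Crux `PerfectScreening.SubharmonicOffOrigin` (stmt-CriticalPhenomena-1341): objects of the line
`certified-core-eventual-tail`

Definitions only (no stub proofs), shared by the positive-side Theorems files of this crux for the
line `certified-core-eventual-tail` of the checked skeleton
`Cruxes/SubharmonicOffOrigin/Lines/certified_core_eventual_tail.lean`
(lead `prover-line-stmt-CriticalPhenomena-1341-0`, 2026-08-16), VERBATIM copies of the skeleton's
bookkeeping objects (which live in a `Cruxes/…/Lines` file and are not importable):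

* `coreRadius` — the sup-norm radius `R₀ = 2` separating the certified core from the far field;
* `InBracket β` — the rigorous β-bracket `1 ≤ 6·tanh β ∧ β ≤ 13/50` of `β_c(3)`;
* `pairMoment E y = E ({0} ∆ {y})` — the pair moment of a set-indexed functional;
* `lapMoment E x` — the Laplacian functional `Σᵢ (E(σ₀σ_{x+eᵢ}) + E(σ₀σ_{x−eᵢ})) − 6·E(σ₀σ_x)`;
* `BracketRows L E` — rows 1–6 of `Literature.Probability.LatticeModels.LatticeBootstrapFeasible`
  verbatim (translation invariance inside `box 3 L`, signed-permutation invariance, reflection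
  positivity in the four lattice mirror types, Griffiths I, the two Messager–Miracle-Solé pair rows),

and small API lemmas: `bracketRows_iff`, `inBracket_iff` (the `Iff.rfl` unfoldings), `pairMoment_zero`
(`pairMoment E 0 = E ∅`, since `{0} ∆ {0} = ∅`), `pairMoment_of_ne_zero`
(`pairMoment E y = E {0, y}` for `y ≠ 0`; registered sub-goal of stmt-CriticalPhenomena-1341) and
`pos_of_inBracket` (`0 < β` on the bracket, the skeleton's sanity link).

References: M. Cho, X. Sun, JHEP 11 (2023) 047, Def. 11–12; J. Fröhlich, R. Israel, E. H. Lieb,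
B. Simon, Comm. Math. Phys. 62 (1978); A. Messager, S. Miracle-Solé, J. Stat. Phys. 17 (1977);
S. Friedli, Y. Velenik, *Statistical Mechanics of Lattice Systems* (CUP 2017), §3.10, §6.2, §10.
-/

noncomputable section

namespace Summit.CriticalPhenomena.Ising3DConformalLimit.Theorems.PerfectScreening.Ccet

open MeasureTheory Finset
open Literature.Probability.LatticeModels

/-! ### Parameters and bookkeeping definitions of the line (verbatim from the skeleton) -/

/-- The CORE RADIUS `R₀` (sup norm): the certificate covers `0 < ‖x‖∞ ≤ R₀` (for `R₀ = 2`: the 9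
point-group classes `(100),(110),(111),(200),(210),(211),(220),(221),(222)`), the far-field partner
covers `‖x‖∞ > R₀`. This one numeral is the interface contract between the two halves; `1` is the
fallback if certificate levels stall (precision needed ≈ 10⁻³ absolute at `R₀ = 1`, ≈ 10⁻⁴ at
`R₀ = 2`). -/
def coreRadius : ℕ := 2

/-- The rigorous β-BRACKET of `β_c(3)`: `1 ≤ 6·tanh β` (i.e. `β ≥ artanh(1/6) = 0.16824…`, the
tree theorem `one_le_two_mul_mul_tanh_criticalBeta` at `d = 3`) and `β ≤ 13/50 = 0.26`
(`stub_order_beyond_threshold`: the Fröhlich–Simon–Spencer infrared bound gives order for `β > G₀(0) = 0.25273…`).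
`β_c(3) ≈ 0.22165` sits inside; the bracket reaches ≈ 17 % into the ordered phase. -/
def InBracket (β : ℝ) : Prop :=
  1 ≤ 6 * Real.tanh β ∧ β ≤ 13 / 50

/-- The pair moment `E(σ₀σ_y)` of a set-indexed functional `E` (`A ↦` candidate value of `⟨σ_A⟩`),
written with the symmetric difference so that `σ₀² = 1` is built in (`y = 0 ↦ E ∅`). -/
def pairMoment (E : Finset (Site 3) → ℝ) (y : Site 3) : ℝ :=
  E (symmDiff {0} {y})

/-- The LAPLACIAN FUNCTIONAL `D_E(x) = Σᵢ (E(σ₀σ_{x+eᵢ}) + E(σ₀σ_{x−eᵢ})) − 6·E(σ₀σ_x)`, a LINEAR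
functional of `E`; for `E = ⟨·⟩⁺_β` it is `Δ_{ℤ³}⟨σ₀σ_·⟩⁺_β (x)`. -/
def lapMoment (E : Finset (Site 3) → ℝ) (x : Site 3) : ℝ :=
  ∑ i : Fin 3, (pairMoment E (x + Pi.single i 1) + pairMoment E (x - Pi.single i 1)) -
    6 * pairMoment E x

/-- The β-INDEPENDENT VALID ROWS of the plus state imposed on a level-`L` functional
`E : Finset (Site 3) → ℝ` — rows 1–6 of `Literature.Probability.LatticeModels.LatticeBootstrapFeasible`
VERBATIM (the β_c-specific Simon-sphere and power-window rows 7–8 of that definition are false on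
the bracket and dropped):
1. translation invariance inside `box 3 L`;
2. invariance under signed coordinate permutations (hyperoctahedral point group);
3. reflection positivity `0 ≤ Σ_{a,b} c_a c_b E(A_a ∆ θA_b)` for the four lattice mirror types
   (site plane `x_i = 0`, bond plane `x_i = 1/2`, diagonal `x_i = x_j`, anti-diagonal `x_i = -x_j`),
   families in the closed positive half-box (Cho–Sun 2023 Def. 12; Fröhlich–Israel–Lieb–Simon 1978);
4. Griffiths' first inequality `0 ≤ E A`;
5. Messager–Miracle-Solé along the axes (pair form, shape of `messager_miracleSole`);
6. Messager–Miracle-Solé away from the diagonals (pair form, shape of `messager_miracleSole_diag`).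
All spin-flip (DLR/Callen) rows, square positivity and `|E A| ≤ 1` are automatic for the
Gibbs-inside functionals `boundaryLawFunctional 3 L β ν` on which these rows are imposed. -/
def BracketRows (L : ℕ) (E : Finset (Site 3) → ℝ) : Prop :=
  (∀ (A : Finset (Site 3)) (v : Site 3), A ⊆ box 3 L → A.image (· + v) ⊆ box 3 L →
      E (A.image (· + v)) = E A) ∧
  (∀ (A : Finset (Site 3)) (π : Equiv.Perm (Fin 3)) (s : Fin 3 → ℤˣ), A ⊆ box 3 L →
      E (A.image (fun x i => (s i : ℤ) * x (π i))) = E A) ∧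
  (∀ (θ : Site 3 → Site 3) (ℓ : Site 3 → ℤ),
      (∃ i j : Fin 3, i ≠ j ∧
        ((θ = fun x => Function.update x i (-x i)) ∧ (ℓ = fun x => x i) ∨
         (θ = fun x => Function.update x i (1 - x i)) ∧ (ℓ = fun x => 2 * x i - 1) ∨
         (θ = fun x => x ∘ Equiv.swap i j) ∧ (ℓ = fun x => x i - x j) ∨
         (θ = fun x => Function.update (Function.update x i (-x j)) j (-x i)) ∧
           (ℓ = fun x => x i + x j))) →
      ∀ (m : ℕ) (A : Fin m → Finset (Site 3)) (c : Fin m → ℝ),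
        (∀ a, A a ⊆ box 3 L ∧ ∀ p ∈ A a, 0 ≤ ℓ p) →
        0 ≤ ∑ a, ∑ b, c a * c b * E (symmDiff (A a) ((A b).image θ))) ∧
  (∀ A : Finset (Site 3), A ⊆ box 3 L → 0 ≤ E A) ∧
  (∀ (x : Site 3) (i : Fin 3), x ≠ 0 → 0 ≤ x i → x ∈ box 3 L → x + Pi.single i 1 ∈ box 3 L →
      E {0, x + Pi.single i 1} ≤ E {0, x}) ∧
  (∀ (x : Site 3) (i j : Fin 3), i ≠ j → x ≠ 0 → x j ≤ x i → x ∈ box 3 L →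
      x + Pi.single i 1 - Pi.single j 1 ∈ box 3 L →
      E {0, x + Pi.single i 1 - Pi.single j 1} ≤ E {0, x})

/-! ### `rfl`-grade API -/

/-- `BracketRows L E` unfolds, by `Iff.rfl`, to the conjunction of its six rows (rows 1–6 of
`LatticeBootstrapFeasible`, verbatim). -/
theorem bracketRows_iff (L : ℕ) (E : Finset (Site 3) → ℝ) :
    BracketRows L E ↔
      ((∀ (A : Finset (Site 3)) (v : Site 3), A ⊆ box 3 L → A.image (· + v) ⊆ box 3 L →
          E (A.image (· + v)) = E A) ∧
      (∀ (A : Finset (Site 3)) (π : Equiv.Perm (Fin 3)) (s : Fin 3 → ℤˣ), A ⊆ box 3 L →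
          E (A.image (fun x i => (s i : ℤ) * x (π i))) = E A) ∧
      (∀ (θ : Site 3 → Site 3) (ℓ : Site 3 → ℤ),
          (∃ i j : Fin 3, i ≠ j ∧
            ((θ = fun x => Function.update x i (-x i)) ∧ (ℓ = fun x => x i) ∨
             (θ = fun x => Function.update x i (1 - x i)) ∧ (ℓ = fun x => 2 * x i - 1) ∨
             (θ = fun x => x ∘ Equiv.swap i j) ∧ (ℓ = fun x => x i - x j) ∨
             (θ = fun x => Function.update (Function.update x i (-x j)) j (-x i)) ∧
               (ℓ = fun x => x i + x j))) →
          ∀ (m : ℕ) (A : Fin m → Finset (Site 3)) (c : Fin m → ℝ),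
            (∀ a, A a ⊆ box 3 L ∧ ∀ p ∈ A a, 0 ≤ ℓ p) →
            0 ≤ ∑ a, ∑ b, c a * c b * E (symmDiff (A a) ((A b).image θ))) ∧
      (∀ A : Finset (Site 3), A ⊆ box 3 L → 0 ≤ E A) ∧
      (∀ (x : Site 3) (i : Fin 3), x ≠ 0 → 0 ≤ x i → x ∈ box 3 L → x + Pi.single i 1 ∈ box 3 L →
          E {0, x + Pi.single i 1} ≤ E {0, x}) ∧
      (∀ (x : Site 3) (i j : Fin 3), i ≠ j → x ≠ 0 → x j ≤ x i → x ∈ box 3 L →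
          x + Pi.single i 1 - Pi.single j 1 ∈ box 3 L →
          E {0, x + Pi.single i 1 - Pi.single j 1} ≤ E {0, x})) :=
  Iff.rfl

/-- `pairMoment` unfolds to `E ({0} ∆ {y})`. -/
theorem pairMoment_apply (E : Finset (Site 3) → ℝ) (y : Site 3) :
    pairMoment E y = E (symmDiff {0} {y}) :=
  rfl

/-- At the origin the pair moment is the empty moment: `{0} ∆ {0} = ∅` (`σ₀² = 1`). -/
theorem pairMoment_zero (E : Finset (Site 3) → ℝ) : pairMoment E 0 = E ∅ := by
  rw [pairMoment_apply, symmDiff_self]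
  rfl

/-- Away from the origin the pair moment is the moment of the pair: `{0} ∆ {y} = {0, y}` for
`y ≠ 0` (registered sub-goal `pairMoment_of_ne_zero` of stmt-CriticalPhenomena-1341). -/
theorem pairMoment_of_ne_zero :
    ∀ (E : Finset (Site 3) → ℝ) (y : Site 3), y ≠ 0 → pairMoment E y = E {0, y} := by
  intro E y hy
  rw [pairMoment_apply]
  congr 1
  ext z
  rw [Finset.mem_symmDiff, Finset.mem_insert, Finset.mem_singleton, Finset.mem_singleton]
  constructor
  · rintro (⟨h, -⟩ | ⟨h, -⟩)
    · exact Or.inl h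
    · exact Or.inr h
  · rintro (h | h)
    · exact Or.inl ⟨h, fun h' => hy (h'.symm.trans h)⟩
    · exact Or.inr ⟨h, fun h' => hy (h.symm.trans h')⟩

/-- The Laplacian functional unfolds to the second-difference combination of pair moments. -/
theorem lapMoment_apply (E : Finset (Site 3) → ℝ) (x : Site 3) :
    lapMoment E x =
      ∑ i : Fin 3, (pairMoment E (x + Pi.single i 1) + pairMoment E (x - Pi.single i 1)) -
        6 * pairMoment E x :=
  rfl

/-- `InBracket β` unfolds to its two inequalities `1 ≤ 6·tanh β` and `β ≤ 13/50`. -/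
theorem inBracket_iff (β : ℝ) : InBracket β ↔ 1 ≤ 6 * Real.tanh β ∧ β ≤ 13 / 50 :=
  Iff.rfl

/-- Every `β` of the bracket is positive (`tanh β ≥ 1/6 > 0`), so the general-`β ≥ 0` feasibility
of the plus state (stub `stub_plusState_feasible`) applies on the bracket (verbatim the
skeleton's sanity link `pos_of_inBracket`). -/
theorem pos_of_inBracket {β : ℝ} (h : InBracket β) : 0 < β := by
  rcases lt_or_ge 0 β with hβ | hβ
  · exact hβ
  · have ht : Real.tanh β ≤ 0 := by
      rw [Real.tanh_eq_sinh_div_cosh]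
      exact div_nonpos_of_nonpos_of_nonneg (Real.sinh_nonpos_iff.2 hβ) (Real.cosh_pos β).le
    linarith [h.1]

end Summit.CriticalPhenomena.Ising3DConformalLimit.Theorems.PerfectScreening.Ccet

end
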